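import Mathlib.RepresentationTheory.Invariants
import Mathlib.NumberTheory.Padics.PadicVal.Basic
import Mathlib.LinearAlgebra.Quotient.Card
import Mathlib.LinearAlgebra.Isomorphisms
import Mathlib.Data.ZMod.Basic
import HarnessLib

/-!
# Invariants are exact on finite `p`-torsion `ℤ[Δ]`-modules when `p ∤ #Δ`:
# `#Y^Δ = #X^Δ · #Z^Δ`, and `V ↦ v_p #V^Δ` is an additive invariant

Topic `RepresentationTheory/FiniteGroups`; namespace `Literature.RepresentationTheory.FiniteGroups`
(sub-namespace `InvariantsPrimeToP`).  THEOREMS ONLY (no definition, no named fact, no `sorry`, no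
instance); Mathlib only.

For a finite group `Δ`, a prime `p` NOT dividing `#Δ` and a short exact sequence
`0 → X → Y → Z → 0` of `ℤ[Δ]`-modules with `Y` finite and killed by `p`, the sequence of invariants
`0 → X^Δ → Y^Δ → Z^Δ → 0` is again exact (averaging `N·Σ_g g` with `N·#Δ ≡ 1 (mod p)` lifts
invariants), so **`natCard_invariants_eq_mul`**: `#Y^Δ = #X^Δ · #Z^Δ`, and
**`additive_padicValNat_card_invariants`**: `ρ ↦ v_p #V^Δ` (`ℤ`-valued) satisfies the additivity
axiom `hψ` of the tree's `StableLatticeReductionInvariantInt` (finite `p`-torsion middle terms) — the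
invariant through which Tate's global Euler–Poincaré characteristic is read at the prime-to-`p` step
(Milne ADT I §5: `θ([N]) = #N^Ḡ`; Serre §15.5 for `p ∤ #G`).  Lane «TATE-EPC-TC» of cell `bsd-eis`,
brick B8-alg (e) (routed by -w7 g9).

## References
* [MilneADT2006] J. S. Milne, *Arithmetic Duality Theorems*, I §5, proof of Thm. 5.1 (the
  homomorphism `θ : R_{𝔽_p}(Ḡ) → ℚ_{>0}`, `θ([N]) = #N^Ḡ`, for `Ḡ` of order prime to `p`).
* [SerreLinearRepresentations1977] J.-P. Serre, *Linear Representations of Finite Groups*, §15.5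
  (`p ∤ #G`: every module is projective; invariants are exact).
-/

universe u

namespace Literature.RepresentationTheory.FiniteGroups

namespace InvariantsPrimeToP

open Function LinearMap Submodule Representation

variable {Δ : Type} [Group Δ] [Fintype Δ] {p : ℕ}

/-- The norm `Σ_g ρ(g) y` is `Δ`-invariant. [cite: SerreLinearRepresentations1977, §2.6 / §15.5] -/
theorem sum_apply_mem_invariants {Y : Type u} [AddCommGroup Y] [Module ℤ Y] (ρ : Representation ℤ Δ Y)
    (y : Y) : ∑ g, ρ g y ∈ invariants ρ := by
  intro h
  rw [map_sum]
  simp_rw [← Module.End.mul_apply, ← map_mul]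
  exact Fintype.sum_bijective (h * ·) (Group.mulLeft_bijective h) _ _ fun _ => rfl

/-- On an invariant vector the norm is multiplication by `#Δ`. [cite: SerreLinearRepresentations1977, §2.6] -/
theorem sum_apply_of_mem_invariants {Y : Type u} [AddCommGroup Y] [Module ℤ Y] (ρ : Representation ℤ Δ Y)
    {y : Y} (hy : y ∈ invariants ρ) : ∑ g, ρ g y = (Fintype.card Δ : ℤ) • y := by
  simp_rw [(mem_invariants ρ y).1 hy]
  rw [Finset.sum_const, Finset.card_univ, natCast_zsmul]

omit [Group Δ] in
/-- An integer inverse of `#Δ` modulo `p` when `p ∤ #Δ`. [cite: SerreLinearRepresentations1977, §15.5] -/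
theorem exists_mul_card_eq_one_add [hp : Fact p.Prime] (hΔ : ¬ p ∣ Fintype.card Δ) :
    ∃ N k : ℤ, N * (Fintype.card Δ : ℤ) = 1 + p * k := by
  have hcop : Nat.Coprime (Fintype.card Δ) p :=
    (Nat.coprime_comm.1 ((Nat.Prime.coprime_iff_not_dvd hp.out).2 hΔ))
  obtain ⟨u, hu⟩ : IsUnit ((Fintype.card Δ : ℕ) : ZMod p) := (ZMod.isUnit_iff_coprime _ _).2 hcop
  set N : ℤ := (((u⁻¹ : (ZMod p)ˣ) : ZMod p).val : ℤ) with hN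
  have h1 : ((N * (Fintype.card Δ : ℤ) : ℤ) : ZMod p) = 1 := by
    rw [Int.cast_mul, hN, Int.cast_natCast, ZMod.natCast_zmod_val, Int.cast_natCast, ← hu,
      Units.inv_mul]
  have h2 : ((N * (Fintype.card Δ : ℤ) - 1 : ℤ) : ZMod p) = 0 := by
    rw [Int.cast_sub, Int.cast_one, h1, sub_self]
  obtain ⟨k, hk⟩ := (ZMod.intCast_zmod_eq_zero_iff_dvd _ p).1 h2
  exact ⟨N, k, by linarith⟩

/-- **Invariants lift along a surjection** when `p ∤ #Δ` and the source is killed by `p`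
(average a preimage). [cite: SerreLinearRepresentations1977, §15.5] [cite: MilneADT2006, I §5 (proof of Thm. 5.1)] -/
theorem exists_mem_invariants_map_eq [hp : Fact p.Prime] (hΔ : ¬ p ∣ Fintype.card Δ)
    {Y Z : Type u} [AddCommGroup Y] [Module ℤ Y] [AddCommGroup Z] [Module ℤ Z]
    (ρY : Representation ℤ Δ Y) (ρZ : Representation ℤ Δ Z) (g : Y →ₗ[ℤ] Z)
    (hg : ∀ s y, g (ρY s y) = ρZ s (g y)) (hgs : Surjective g) (hpY : ∀ y : Y, (p : ℤ) • y = 0)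
    {z : Z} (hz : z ∈ invariants ρZ) : ∃ y ∈ invariants ρY, g y = z := by
  rename_i instY _ instZ
  cases Subsingleton.elim instY (AddCommGroup.toIntModule Y)
  cases Subsingleton.elim instZ (AddCommGroup.toIntModule Z)
  obtain ⟨y₀, rfl⟩ := hgs z
  obtain ⟨N, k, hNk⟩ := exists_mul_card_eq_one_add (p := p) hΔ
  refine ⟨N • ∑ h, ρY h y₀, Submodule.smul_mem _ N (sum_apply_mem_invariants ρY y₀), ?_⟩
  rw [map_smul, map_sum]
  simp_rw [hg]
  rw [sum_apply_of_mem_invariants ρZ hz, smul_smul, hNk, add_smul, one_smul, mul_comm, mul_smul,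
    ← map_smul g (p : ℤ) y₀, hpY, map_zero, smul_zero, add_zero]

/-- `#M = #(ker φ) · #(range φ)` for a linear map out of a finite module. [folklore] -/
private theorem natCard_eq_ker_mul_range {M N : Type u} [AddCommGroup M] [Module ℤ M] [AddCommGroup N]
    [Module ℤ N] [Finite M] (φ : M →ₗ[ℤ] N) :
    Nat.card M = Nat.card (LinearMap.ker φ) * Nat.card (LinearMap.range φ) := by
  rw [Submodule.card_eq_card_quotient_mul_card (LinearMap.ker φ),
    Nat.card_congr φ.quotKerEquivRange.toEquiv]

/-- **Exactness of invariants for `p ∤ #Δ`: `#Y^Δ = #X^Δ · #Z^Δ`** for a short exact sequence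
`0 → X → Y → Z → 0` of `ℤ[Δ]`-modules with `Y` finite and killed by `p`.
[cite: MilneADT2006, I §5, proof of Thm. 5.1 (`θ([N]) = #N^Ḡ` is a homomorphism on `R_{𝔽_p}(Ḡ)`)]
[cite: SerreLinearRepresentations1977, §15.5] -/
theorem natCard_invariants_eq_mul [hp : Fact p.Prime] (hΔ : ¬ p ∣ Fintype.card Δ)
    {X Y Z : Type u} [AddCommGroup X] [Module ℤ X] [AddCommGroup Y] [Module ℤ Y]
    [AddCommGroup Z] [Module ℤ Z] (ρX : Representation ℤ Δ X) (ρY : Representation ℤ Δ Y)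
    (ρZ : Representation ℤ Δ Z) (f : X →ₗ[ℤ] Y) (g : Y →ₗ[ℤ] Z)
    (hf : ∀ s x, f (ρX s x) = ρY s (f x)) (hg : ∀ s y, g (ρY s y) = ρZ s (g y))
    (hfi : Injective f) (hgs : Surjective g) (hex : LinearMap.range f = LinearMap.ker g) [Finite Y]
    (hpY : ∀ y : Y, (p : ℤ) • y = 0) :
    Nat.card (invariants ρY) = Nat.card (invariants ρX) * Nat.card (invariants ρZ) := by
  classical
  rename_i instX _ instY _ instZ _
  cases Subsingleton.elim instX (AddCommGroup.toIntModule X)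
  cases Subsingleton.elim instY (AddCommGroup.toIntModule Y)
  cases Subsingleton.elim instZ (AddCommGroup.toIntModule Z)
  -- `g` restricted to invariants
  let g' : invariants ρY →ₗ[ℤ] invariants ρZ :=
    LinearMap.codRestrict _ (g ∘ₗ (invariants ρY).subtype) fun y => by
      intro s
      rw [LinearMap.comp_apply, Submodule.subtype_apply, ← hg, (mem_invariants ρY _).1 y.2 s]
  haveI : Finite (invariants ρY) := inferInstance
  -- range = everything
  have hrange : LinearMap.range g' = ⊤ := by
    rw [eq_top_iff]
    rintro z -
    obtain ⟨y, hy, hyz⟩ := exists_mem_invariants_map_eq hΔ ρY ρZ g hg hgs hpY z.2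
    exact ⟨⟨y, hy⟩, Subtype.ext (show ((g' ⟨y, hy⟩ : invariants ρZ) : Z) = z from hyz)⟩
  -- kernel ≅ X^Δ via `f`
  let f' : invariants ρX →ₗ[ℤ] LinearMap.ker g' :=
    LinearMap.codRestrict _ (LinearMap.codRestrict (invariants ρY) (f ∘ₗ (invariants ρX).subtype)
      fun x => by
        intro s
        rw [LinearMap.comp_apply, Submodule.subtype_apply, ← hf, (mem_invariants ρX _).1 x.2 s])
      fun x => by
        rw [LinearMap.mem_ker]
        apply Subtype.ext
        change g (f (x : X)) = 0
        have : f (x : X) ∈ LinearMap.ker g := hex ▸ LinearMap.mem_range_self f _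
        exact LinearMap.mem_ker.1 this
  have hf'bij : Bijective f' := by
    constructor
    · intro a b hab
      have h' : f (a : X) = f (b : X) :=
        congrArg (fun y : LinearMap.ker g' => ((y : invariants ρY) : Y)) hab
      exact Subtype.ext (hfi h')
    · rintro ⟨⟨y, hyinv⟩, hyker⟩
      have hy0 : g y = 0 :=
        congrArg (fun z : invariants ρZ => (z : Z)) (LinearMap.mem_ker.1 hyker)
      obtain ⟨x, rfl⟩ : y ∈ LinearMap.range f := by rw [hex]; exact LinearMap.mem_ker.2 hy0
      have hx : x ∈ invariants ρX := fun s => hfi (by rw [hf]; exact hyinv s)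
      exact ⟨⟨x, hx⟩, Subtype.ext (Subtype.ext rfl)⟩
  rw [natCard_eq_ker_mul_range g', hrange, ← Nat.card_congr (Equiv.ofBijective f' hf'bij),
    Nat.card_congr (LinearEquiv.ofTop _ rfl).toEquiv]

/-- **`ρ ↦ v_p #V^Δ` is an additive invariant on finite `p`-torsion `ℤ[Δ]`-modules for `p ∤ #Δ`**,
in the binder shape `hψ` of the tree's `StableLatticeReductionInvariantInt` (`ℤ`-valued).
[cite: MilneADT2006, I §5, proof of Thm. 5.1] [cite: SerreLinearRepresentations1977, §15.5] -/
theorem additive_padicValNat_card_invariants [hp : Fact p.Prime] (hΔ : ¬ p ∣ Fintype.card Δ) :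
    ∀ ⦃X Y Z : Type u⦄ [AddCommGroup X] [Module ℤ X] [AddCommGroup Y] [Module ℤ Y]
      [AddCommGroup Z] [Module ℤ Z] (ρX : Representation ℤ Δ X) (ρY : Representation ℤ Δ Y)
      (ρZ : Representation ℤ Δ Z) (f : X →ₗ[ℤ] Y) (g : Y →ₗ[ℤ] Z),
      (∀ s x, f (ρX s x) = ρY s (f x)) → (∀ s y, g (ρY s y) = ρZ s (g y)) →
      Injective f → Surjective g → LinearMap.range f = LinearMap.ker g → Finite Y →
      (∀ y : Y, (p : ℤ) • y = 0) →
      (padicValNat p (Nat.card (invariants ρY)) : ℤ) =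
        (padicValNat p (Nat.card (invariants ρX)) : ℤ) + (padicValNat p (Nat.card (invariants ρZ)) : ℤ) := by
  intro X Y Z _ _ _ _ _ _ ρX ρY ρZ f g hf hg hfi hgs hex hfin hpY
  haveI := hfin
  haveI : Finite X := Finite.of_injective f hfi
  haveI : Finite Z := Finite.of_surjective g hgs
  rw [natCard_invariants_eq_mul hΔ ρX ρY ρZ f g hf hg hfi hgs hex hpY, ← Nat.cast_add,
    padicValNat.mul (Nat.card_pos.ne') (Nat.card_pos.ne')]

end InvariantsPrimeToP

end Literature.RepresentationTheory.FiniteGroups
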